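import Summits.HodgeConjecture.HodgeConjecture.Theorems.F0P6aOrganB3Src                              -- ★ p851009 (B3-SRC) `organB3Src_holds` (LA4-p03 (g3))
import Summits.HodgeConjecture.HodgeConjecture.Theorems.F0P6aChartFramePin                            -- ★ re-homed (D) `AuxChartGS`∕`IsCMTypeThrough` + the frame pin `IsChartOfFrame`
import Summits.HodgeConjecture.HodgeConjecture.Theorems.F0P6aStubE6Sockets                             -- ★ re-homed σ1 `RingActionReading`
import Literature.AlgebraicGeometry.ModuliOfAbelianVarieties.SiegelCMHomAlongGlobalTupleIso            -- ★ p850815 (B3)-adapter `pullback_map_comp_eq_of_lifts_of_globalIso`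
import Literature.AlgebraicGeometry.ShimuraVarieties.UnitaryShimuraCurveSpecialSheetPointTwist         -- ★ p850898 `hpt` (LA4-p04 (g4))
import Literature.AlgebraicGeometry.AbelianSchemes.SerreTwistModuliTupleRowA                          -- ★ `serreTensor`∕`serreAction`∕`serreTranslate`∕`IsExactTwistPol`
import Literature.AlgebraicGeometry.AbelianSchemes.AbelianSchemeFixedPowBaseChange                     -- ★ `RingAction.baseChange`
import Literature.AlgebraicGeometry.Motives.VarietiesGeometricallyIntegralProofs                        -- ★ `isReduced_of_smooth_over_field`
import Literature.AlgebraicGeometry.ShimuraVarieties.UnitaryAuxiliaryTorusDatum                        -- ★ `Aux.reflexField`, `numberField_reflexField`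
import Literature.NumberTheory.ComplexMultiplication.ReflexNormIdeles                                   -- ★ `reflexNormFiniteIdele`
import Literature.NumberTheory.ComplexMultiplication.CMTypeBasic                                        -- ★ `CMTypeOps.flip`∕`bar`
import Literature.NumberTheory.Automorphic.IdeleIdealClass                                              -- ★ `FiniteAdeleRing.toFractionalIdeal`
import Literature.NumberTheory.GaloisRepresentations.HeckeCharacterOfRayClass                           -- ★ `modulusExp`
import HarnessLib

/-!
# ORGAN (B3) PAID — `hact` at the special sheet points of the (γ′) E-sheet road («the fibre of the global tuple iso intertwines `serreAction` and `ρ^γ`»)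
# ([Milne2005ShimuraVarieties] §14 Prop. 14.12, Thm. 6.11; [Shimura1998] §18.6 Thm. 18.6; [MumfordFogartyKirwan1994] Ch. 6 §1, Ch. 7 §3)

Cell `hodgecm-mathlib` (D-0151), FLOOR 0, P6 «MOD», crux hLiu418 (stmt-HodgeConjecture-24832, `--supports`, count-neutral), line «L4», closer
`Lines/F0_P6a_StubESHEET.lean`, socket `hole_SHEET_global` (pen ruling v2, LA4-plan (g2) 2026-09-02 09:59Z), glue leaf `F0P6aStubESHEETGlobalGlue` (LA7-p01 (g4)
frame v1 709ce1f8: `organSHEETGlobal_of_organs : OrganB1 → OrganB2 → OrganB3 → OrganSHEETGlobalCore`).  THIS FILE pays **`OrganB3`** (pen LA6-p02 (g3) by the ruling)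
in the ★ lane: the head `organB3_holds` has the TYPE of the glue frame's §2c `def OrganB3` (:645–:687) TOKEN FOR TOKEN, read over the ★ re-homed defs
(`Theorems.F0P6aPELWitnessEDefs`, `Theorems.F0P6aStubE6Sockets`, `Theorems.F0P6aChartFramePin` — same fully-qualified names as the `Lines/` originals), with the ONE
hypothesis `IsSheetTwistOf …` UNFOLDED into its rows (the junction def is a `Lines/` original; `theorem organB3 : OrganB3 := organB3_holds` then closes by `delta` in the
glue leaf).  PROOF: per `(γ₁, 𝔞, n, twist rows, presentation, Db, polB, lvl′, hex, h5, E, hlam, hlvl, eE, heE, w, hw, a, b)` — `X` is reduced and locally Noetherian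
(smooth over `Fᵢ`); the (B3-SRC) package ★ `F0P6aOrganB3Src.organB3Src_holds` (LA4-p03 (g3): sheet lift `σ`, source point with `hpt` ★ p850898, σ1's CM datum, the
marked Serre-tensor fibre #42 with its tower ★ p850830, the CM hom `(f, k, hf)` with its intertwining ★ p850737); then ONE call of ★ p850815
`SiegelAdelicMarking.pullback_map_comp_eq_of_lifts_of_globalIso` (instances passed positionally: the organ's `E` lives in `Over X.left` while the base of `gγ` is spelled
`GaloisDescent.bc Fᵢ (M_Kc)` — definitionally, not reducibly, equal).  THEOREMS ONLY (no def, no instance, no named fact, no `sorry`).  HONEST LABEL: HC_CM is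
proved only modulo the 7 printed citations (2 remaining: hLiu418 = stmt-HodgeConjecture-24832, h413 = stmt-HodgeConjecture-24833) until rung 0 closes.

## References
* [Milne2005ShimuraVarieties] J. S. Milne, *Introduction to Shimura varieties* (2005), §14 Prop. 14.12 p. 125, §6 Thm. 6.11 pp. 74–75, §11 Thm. 11.2 p. 108.
* [Shimura1998] G. Shimura, *Abelian Varieties with Complex Multiplication and Modular Functions* (1998), §18.6 Thm. 18.6 pp. 124–125.
* [MumfordFogartyKirwan1994] D. Mumford, J. Fogarty, F. Kirwan, *Geometric Invariant Theory*, 3rd ed. (1994), Ch. 6 §1 Cor. 6.2 (p. 116), Ch. 7 §3 (lemma of Serre).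
* [Kottwitz1992] R. Kottwitz, JAMS 5 (1992), §5 (p. 390).
-/

set_option autoImplicit false

noncomputable section

set_option linter.dupNamespace false  -- `Summit.HodgeConjecture.HodgeConjecture.…` BY DESIGN (D-0017)

namespace Summit.HodgeConjecture.HodgeConjecture.Theorems.F0P6aOrganB3

open CategoryTheory CategoryTheory.Limits NumberField IsDedekindDomain MulAction AlgebraicGeometry Topology
open scoped Matrix Polynomial Pointwise nonZeroDivisors MonObj
open Literature.NumberTheory.GaloisRepresentations
open Literature.NumberTheory.Automorphic Literature.NumberTheory.Automorphic.UnitaryGroup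
open Literature.AlgebraicGeometry.ShimuraVarieties Literature.AlgebraicGeometry.ShimuraVarieties.UnitaryCanonicalModel
open Literature.NumberTheory.Automorphic.Liu2021.AppendixC
open Literature.AlgebraicGeometry.Motives (AlgPoints ComplexPoints SchemeOver thickeningLift specOver CartierDivisor CMType AbelianVariety)
open Literature.AlgebraicGeometry.Motives.AbelianVariety (bcSpec)
open Literature.AlgebraicGeometry.AbelianSchemes (PolarizedAbelianSchemeWithLevel AbelianSchemeOver)
open Literature.AlgebraicGeometry.ModuliOfAbelianVarieties
open Summit.HodgeConjecture.HodgeConjecture.Cruxes.HLiu418.F0P6aPELWitnessE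
open Summit.HodgeConjecture.HodgeConjecture.Cruxes.HLiu418.F0P6aStubE6 (RingActionReading)
open Summit.HodgeConjecture.HodgeConjecture.Cruxes.HLiu418.F0P6aChartFramePin (IsChartOfFrame)
open Literature.AlgebraicGeometry.ShimuraVarieties.UnitaryCanonicalModel.Aux (ratBasis torusFinAdelic reflexField numberField_reflexField)
open Literature.AlgebraicGeometry.ShimuraVarieties.UnitaryCurve Literature.AlgebraicGeometry.ShimuraVarieties.UnitaryCurve.AuxV
open Literature.NumberTheory.ComplexMultiplication (reflexNormFiniteIdele)
open Literature.NumberTheory.ComplexMultiplication.CMTypeOps (flip bar)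

/-! ### §1 The head: ORGAN (B3) holds -/

set_option maxHeartbeats 400000 in
/-- **ORGAN (B3) = (R-CM) «`hact` AT THE SPECIAL SHEET POINTS» HOLDS** — the glue frame's §2c `OrganB3` text (junction rows unfolded): in the letter's chart context,
for every sheet-twist datum `(γ₁, 𝔞, n)`, every Serre presentation of `𝔞⁻¹` with scalar `n`, every unit-normalised `Db`, exact `λ_B`, transported `η_B` on
`B := P.A ⊗ 𝔞⁻¹`, and EVERY isomorphism `E : B ≅ (P.A).baseChange gγ` over `X` exact on polarisations and level sections, the fibre of `E` at every special sheet
point `ℓ_{eE}(z₀)` intertwines `serreAction` and `ρ.baseChange gγ` — (B3-SRC) ★ `organB3Src_holds` ⊕ ★ p850815 `pullback_map_comp_eq_of_lifts_of_globalIso`.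
[cite: Milne2005ShimuraVarieties, §14 Prop. 14.12 p. 125; §6 Thm. 6.11 pp. 74–75] [cite: Shimura1998, §18.6 Thm. 18.6 pp. 124–125] [cite: MumfordFogartyKirwan1994, Ch. 6 §1 Corollary 6.2 (p. 116) and Ch. 7 §3 (lemma of Serre)] -/
theorem organB3_holds :
  ∀ (F : Type) [Field F] [NumberField F] [IsCMField F] [IsGalois ℚ F] (ι₁ : F →+* ℂ)
    (Jstar : Matrix (Fin 2) (Fin 2) F) (_hJ : (Jstar.map (IsCMField.complexConj F))ᵀ = Jstar) (_hJu : IsUnit Jstar)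
    (K₀ : C5.OpenCompactSubgroup (GSAdele F Jstar)) (S : RecordSystemGS F Jstar ι₁ K₀) (_hU7ₛ : S.HeckeTranslateDefinedOver) (Kc : C5.SmallLevel K₀)
    (Fi : Type) [Field Fi] [NumberField Fi] [Algebra F Fi] [IsGalois F Fi] (τE : Fi →+* ℂ) (_hτE : τE.comp (algebraMap F Fi) = ι₁)
    (Φ : Set (F →+* ℂ)) (hΦ : IsCMTypeThrough ι₁ Φ) (C : AuxChartGS F ι₁ Jstar K₀ S Kc Fi τE Φ)
    (ξ : F) (k : ℕ) (Fr : SymplecticFrameV F (RingHom.id F) Jstar ((k : ℚ) • ξ) C.g C.δ) (_hpin : IsChartOfFrame hΦ C ξ k Fr)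
    (ε : (Literature.AlgebraicGeometry.Motives.baseChange F Fi).obj (S.M.obj Kc) ⟶
        (Literature.AlgebraicGeometry.Motives.baseChange ℚ Fi).obj C.𝓜.M)
    (_hε : letI : Algebra Fi ℂ := τE.toAlgebra
      ∀ (P : ComplexPoints ((Literature.AlgebraicGeometry.Motives.baseChange F Fi).obj (S.M.obj Kc)))
        (Pflat : letI : Algebra F ℂ := ι₁.toAlgebra; ComplexPoints (S.M.obj Kc)),
        Pflat.left = P.left ≫ pullback.fst (S.M.obj Kc).hom (bcSpec F Fi) →
        (AlgPoints.map ε P).left ≫ pullback.fst C.𝓜.M.hom (bcSpec ℚ Fi) =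
          (letI : Algebra F ℂ := ι₁.toAlgebra; (C.f (S.pts Kc Pflat)).left))
    (ρ : AbelianSchemeOver.RingAction (𝓞 F) (C.𝓜.univ.baseChange (ε.left ≫ pullback.fst C.𝓜.M.hom (bcSpec ℚ Fi))).A),
    RingActionReading C ε ρ →
    ∀ (γ₁ : Fi ≃ₐ[F] Fi) (𝔞 : Ideal (𝓞 F)) (n : ℕ),
      (Ideal.span {((n : ℕ) : 𝓞 F)} = 𝔞 * (IsCMField.complexConj F) • 𝔞 ∧
        𝔞 ⊔ Ideal.span {((C.N : ℕ) : 𝓞 F)} = ⊤ ∧ 𝔞 ≠ ⊥ ∧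
        haveI : NumberField ↥(reflexField F (flip ι₁ (bar (⟨Φ, hΦ.2⟩ : CMType F))) ι₁) :=
          numberField_reflexField F (flip ι₁ (bar (⟨Φ, hΦ.2⟩ : CMType F))) ι₁
        ∃ (γ' : ℂ ≃+* ℂ)
          (sE : (FiniteAdeleRing (𝓞 ↥(reflexField F (flip ι₁ (bar (⟨Φ, hΦ.2⟩ : CMType F))) ι₁))
            ↥(reflexField F (flip ι₁ (bar (⟨Φ, hΦ.2⟩ : CMType F))) ι₁))ˣ)
          (z : (FiniteAdeleRing (𝓞 F) F)ˣ),
          (∀ x : Fi, γ' (τE x) = τE (γ₁ x)) ∧ (∀ x : F, γ' (ι₁ x) = ι₁ x) ∧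
          IsArtinCorrespondent ↥(reflexField F (flip ι₁ (bar (⟨Φ, hΦ.2⟩ : CMType F))) ι₁)
            (algebraMap ↥(reflexField F (flip ι₁ (bar (⟨Φ, hΦ.2⟩ : CMType F))) ι₁) ℂ) sE γ' ∧
          z = reflexNormFiniteIdele F (flip ι₁ (bar (⟨Φ, hΦ.2⟩ : CMType F)))
            (reflexField F (flip ι₁ (bar (⟨Φ, hΦ.2⟩ : CMType F))) ι₁) sE ∧
          FiniteAdeleRing.toFractionalIdeal (𝓞 F) F z = ((𝔞 : FractionalIdeal (𝓞 F)⁰ F))⁻¹ ∧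
          ∀ v : HeightOneSpectrum (𝓞 F), Ideal.span {((C.N : ℕ) : 𝓞 F)} ≤ v.asIdeal →
            Valued.v ((z : FiniteAdeleRing (𝓞 F) F) v) = 1 ∧
            Valued.v ((z : FiniteAdeleRing (𝓞 F) F) v - 1) ≤ WithZero.exp (-(modulusExp (Ideal.span {((C.N : ℕ) : 𝓞 F)}) v : ℤ))) →
      letI P := C.𝓜.univ.baseChange (ε.left ≫ pullback.fst C.𝓜.M.hom (bcSpec ℚ Fi))
      letI X := (Literature.AlgebraicGeometry.Motives.baseChange F Fi).obj (S.M.obj Kc)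
      letI gγ : X.left ⟶ X.left := Literature.AlgebraicGeometry.Motives.GaloisDescent.gal Fi (S.M.obj Kc) γ₁⁻¹
      letI : Algebra F ℂ := ι₁.toAlgebra
  ∀ [IsCommMonObj P.A.X] (m : ℕ) (E' : Matrix (Fin m) (Fin m) (𝓞 F)) (hE' : E' * E' = E') (Pm : Matrix (Fin m) (Fin 1) (𝓞 F))
    (Qm : Matrix (Fin 1) (Fin m) (𝓞 F)),
    E' * Pm = Pm → Qm * E' = Qm → Qm * Pm = Matrix.scalar (Fin 1) ((n : ℕ) : 𝓞 F) → Pm * Qm = Matrix.scalar (Fin m) ((n : ℕ) : 𝓞 F) * E' →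
    Ideal.span (Set.range fun j => Pm j 0) = 𝔞 →
    ∀ (Db : (AbelianSchemeOver.serreTensor ρ E' hE').DualPair)
      (_hDb : Nonempty ((Scheme.Modules.pullback (AbelianSchemeOver.DualPair.unitHatSlice Db)).obj Db.P ≅ SheafOfModules.unit _))
      (polB : (AbelianSchemeOver.serreTensor ρ E' hE').Polarization Db)
      (lvl' : (AbelianSchemeOver.serreTensor ρ E' hE').LevelStructure C.g C.N),
      AbelianSchemeOver.IsExactTwistPol ρ E' hE' Pm P.D Db P.pol n polB.lam →
      (∀ i, lvl'.σ i = P.level.σ i ≫ AbelianSchemeOver.serreTranslate ρ E' hE' Pm) →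
      ∀ (E : (AbelianSchemeOver.serreTensor ρ E' hE').X ≅ (P.A.baseChange gγ).X) (_ : IsMonHom E.hom),
        E.hom ≫ (P.pol.baseChange gγ).lam ≫ AbelianSchemeOver.DualPair.dualIsogenyOver E.hom Db (P.D.baseChange gγ) = polB.lam →
        (∀ i, lvl'.σ i ≫ E.hom = (P.level.baseChange gγ).σ i) →
        ∀ (eE : Fi →ₐ[F] ℂ), (∀ x, eE x = τE x) →
          ∀ (w : Fin 2 → F) (hw : (fun i => ι₁ (w i)) ∈ negCone (Jstar.map ι₁)) (a : GSAdele F Jstar) (b : 𝓞 F),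
            (Over.pullback (thickeningLift eE (S.M.obj Kc)
                ((S.pts Kc).symm (ShimuraSetGS.mk F Jstar ι₁ Kc.1.1 (fun i => ι₁ (w i)) hw a))).left).map
                ((AbelianSchemeOver.serreAction ρ E' hE').i b ≫ E.hom) =
              (Over.pullback (thickeningLift eE (S.M.obj Kc)
                ((S.pts Kc).symm (ShimuraSetGS.mk F Jstar ι₁ Kc.1.1 (fun i => ι₁ (w i)) hw a))).left).map
                (E.hom ≫ (ρ.baseChange gγ).i b)
 := by
  intro F _ _ _ _ ι₁ Jstar hJ hJu K₀ S hU7 Kc Fi _ _ _ _ τE hτE Φ hΦ C ξ k Fr hpin ε hε ρ hR γ₁ 𝔞 n htw _ m E' hE' Pm Qm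
    hP hQ hQP hPQ hspan Db hDb polB lvl' hex h5 E hE hlam hlvl eE heE w hw a b
  -- the (B3-SRC) package at this special sheet point
  obtain ⟨σ, s, hpt, J, a₁, kk, Θ₁, h₁, Λ₁, m₁, hΛ₁, r, hr, Z, hZ, m₂, Θ₂, hΘ₂, Λ₂, hΛ₂, f, hk, hf, hint⟩ :=
    F0P6aOrganB3Src.organB3Src_holds F ι₁ Jstar hJ hJu K₀ S hU7 Kc Fi τE hτE Φ hΦ C ξ k Fr hpin ε hε ρ hR γ₁ 𝔞 n htw m E' hE' Pm Qm
      hP hQ hQP hPQ hspan Db hDb polB lvl' hex h5 eE heE w hw a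
  -- `X` is reduced and locally Noetherian (smooth over the field `Fᵢ`)
  haveI := S.smooth Kc
  haveI : Smooth (S.M.obj Kc).hom := SmoothOfRelativeDimension.smooth 1 _
  haveI : Smooth ((Literature.AlgebraicGeometry.Motives.baseChange F Fi).obj (S.M.obj Kc)).hom := by
    change Smooth (pullback.snd (S.M.obj Kc).hom _)
    infer_instance
  haveI : IsLocallyNoetherian ((Literature.AlgebraicGeometry.Motives.baseChange F Fi).obj (S.M.obj Kc)).left :=
    LocallyOfFiniteType.isLocallyNoetherian ((Literature.AlgebraicGeometry.Motives.baseChange F Fi).obj (S.M.obj Kc)).hom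
  haveI : IsReduced ((Literature.AlgebraicGeometry.Motives.baseChange F Fi).obj (S.M.obj Kc)).left :=
    Literature.AlgebraicGeometry.Motives.isReduced_of_smooth_over_field
      ((Literature.AlgebraicGeometry.Motives.baseChange F Fi).obj (S.M.obj Kc)).hom
  -- the same instances on the `GaloisDescent.bc` spelling of `X.left` (the base of `gγ`; definitional)
  haveI : IsLocallyNoetherian (Literature.AlgebraicGeometry.Motives.GaloisDescent.bc Fi (S.M.obj Kc)) :=
    ‹IsLocallyNoetherian ((Literature.AlgebraicGeometry.Motives.baseChange F Fi).obj (S.M.obj Kc)).left›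
  haveI : IsReduced (Literature.AlgebraicGeometry.Motives.GaloisDescent.bc Fi (S.M.obj Kc)) :=
    ‹IsReduced ((Literature.AlgebraicGeometry.Motives.baseChange F Fi).obj (S.M.obj Kc)).left›
  haveI : IsMonHom E.hom := hE
  haveI := ρ.isMonHom b
  haveI := (AbelianSchemeOver.serreAction ρ E' hE').isMonHom b
  have hg : 0 < C.g := by rw [C.g_eq]; exact Module.finrank_pos
  -- ★ p850815 with the `IsMonHom` instances passed POSITIONALLY (the organ's `E` lives in `Over X.left` while the base of `gγ` is spelled
  -- `GaloisDescent.bc Fi (S.M.obj Kc)` — definitionally equal, not reducibly, so instance search cannot be used)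
  exact @SiegelAdelicMarking.pullback_map_comp_eq_of_lifts_of_globalIso _ _ _ _ _ _ _ _ _ _ _ _ _ _ _ _ _ _ _ _
    hg C.hδ C.hN σ (C.𝓜.univ.baseChange (ε.left ≫ pullback.fst C.𝓜.M.hom (bcSpec ℚ Fi))).pol _ h₁ Λ₁ m₁ hΛ₁
    (Literature.AlgebraicGeometry.Motives.GaloisDescent.gal Fi (S.M.obj Kc) γ₁⁻¹) hpt polB hr hZ m₂ _ hΘ₂ Λ₂ hΛ₂ E hE hlam hlvl f hk hf
    (ρ.i b) (ρ.isMonHom b) ((AbelianSchemeOver.serreAction ρ E' hE').i b) ((AbelianSchemeOver.serreAction ρ E' hE').isMonHom b) (hint b)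

end Summit.HodgeConjecture.HodgeConjecture.Theorems.F0P6aOrganB3

end
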